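import Literature.Barriers.QuantumFields.HaagTheoremHolds
import HarnessLib

/-!
# Haag's theorem through the time-zero two-point function (barrier audit of `HaagTheoremSteps`)

Sibling theorem file (theorems only, no new definitions) of
`Literature/Barriers/QuantumFields/HaagTheoremSteps.lean` (barrier catalogue D-0021, summit
`QuantumFields`), recording the outcome of the 2026-08-16 barrier audit of that file.

**Audit.** The two named inputs of Streater–Wightman's printed proof of Thm 4-16 vendored in
`HaagTheoremSteps` — the analytic-continuation step `HaagTwoPointContinuation` (proof of Thm 4-16
after (4-85), held 2000 printing PDF p. 149; Thm 4-17 with `n = 2`, PDF pp. 149–150; Talagrand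
Thm M.4.12, PDF p. 836) and the Jost–Schroer theorem `JostSchroerTheorem` (Thm 4-15, PDF
pp. 146–148) — are faithful to the printed statements and are THEOREMS of the tree
(`HaagTwoPointContinuation_holds`, `JostSchroerTheorem_holds`, whence `HaagTheorem_holds`; axioms
`propext`, `Classical.choice`, `Quot.sound`). What the machine-checked proofs consume is narrower
than the hypotheses displayed in `HaagTheorem`:

* the continuation step uses, of `SharpTimeField.IsHaagSystem`, only the slicing identity
  `slice`, the time derivative `hasDerivAt` (continuity in `t`) and `hermitian_φ`, and of the
  equal-time data (4-76) only the `n = 2` expectation values `⟪Ω, φ₀(f) φ₀(g) Ω⟫`; it holds in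
  every space dimension (`wightmanFn_two_eq_of_equalTimeVEV_eq'`); its Wightman-side inputs are
  Poincaré covariance and the spectral condition of both theories (Thm 3-5, Bargmann–Hall–Wightman
  Thm 2-11, one boost to equal times);
* the unitary `V` of (4-73), the conjugate fields `φ̇₀`, irreducibility, Euclidean covariance and
  the uniqueness of the invariant state enter only through Thm 4-14, i.e. only to produce
  `V Ω₁ = c Ω₂` and hence the equality (4-85) of the time-zero two-point expectation values.

Consequently the Streater–Wightman route proves the following `V`-free form, recorded here as the
theorem `isFreeHermitianScalarField_of_equalTimeVEV_pair_eq`: *a Wightman QFT of one hermitian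
scalar field on `ℝ^{1+3}` with a sharp-time restriction whose time-zero two-point function
`⟪Ω, φ₀(f) φ₀(g) Ω⟫` is that of a free field of mass `m > 0` is the free field of mass `m`* — the
time-zero Källén–Lehmann argument of Talagrand App. M.4 (Lemma M.4.15: equality of the two-point
function at space-like separation forces `dρ = δ_{m₀}`) completed by Thm 4-15. For idea triage this
is the sharp test behind the catalogued barrier `HaagTheorem`: a candidate interacting theory is
excluded as soon as ITS OWN vacuum reproduces the free time-zero covariance of some mass `m > 0`
(for instance a Gaussian time-zero vacuum functional with the free covariance `(2ω_m)⁻¹`), with no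
interaction-picture, canonical-momentum, irreducibility or unique-vacuum hypothesis; conversely
nothing here constrains a theory whose time-zero two-point function is not a free one
(wave-function renormalisation `Z ≠ 1`, the generic interacting situation [Haag 1996, §II.1.1
(II.1.4), pp. 54–55]). `HaagTheorem` itself factors through this interface: Thm 4-14
(`HaagEqualTime_holds`) turns the hypotheses of `HaagTheorem` into (4-85), i.e. the hypothesis
`hvev` below, and the theorem concludes (this re-assembly has the type of `HaagTheorem_holds` and
is therefore not restated as a declaration).

**Literature on the two steps (audit).** Both steps are wider than formalised, not narrower: the
continuation step is printed for arbitrary covariant field multiplets and `n ≤ 4` points (Thm 4-17;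
`GeneralizedHaagTheorem_holds`), and the Jost–Schroer theorem — proved independently by
Federbush–Johnson [FederbushJohnson1960] — holds for zero mass in `3 + 1` dimensions
[Pohlmeyer1969], for string-localised fields (Steinmann 1982) and, in the Haag–Kastler setting, for
massive theories with temperate polarisation-free generators [Mund2012, abstract and §1]; the
tree's `JostSchroerTheorem` (`d = 3`, `m > 0`, point-like scalar field) is the printed special case.

## References

* R. F. Streater, A. S. Wightman, *PCT, Spin and Statistics, and All That*, §4-5, Thms 4-14–4-17,
  (4-76), (4-85) (held 2000 printing, PDF pp. 146–150). [StreaterWightman2001]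
* M. Talagrand, *What Is a Quantum Field Theory?* (2022), App. M, Thm M.2.1 (PDF p. 826),
  Prop. M.4.11–Lemma M.4.15 and Thm M.4.12 (PDF p. 836). [Talagrand2022]
* R. Haag, *Local Quantum Physics* (2nd ed. 1996), §II.1.1, pp. 54–55. [Haag1996]
* P. G. Federbush, K. A. Johnson, Uniqueness property of the twofold vacuum expectation value,
  Phys. Rev. 120 (1960) 1926. [FederbushJohnson1960]
* K. Pohlmeyer, The Jost–Schroer theorem for zero-mass fields, Comm. Math. Phys. 12 (1969)
  204–211. [Pohlmeyer1969]
* J. Mund, An algebraic Jost–Schroer theorem for massive theories, Comm. Math. Phys. 315 (2012)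
  445–464, arXiv:1012.1454. [Mund2012]
-/

noncomputable section

open scoped SchwartzMap

namespace Literature.Barriers.QuantumFields

open Literature.MathematicalPhysics.QuantumLattice

/-- **Haag's theorem through the time-zero two-point function (Streater–Wightman Thms 4-15/4-16
without the interaction picture).** Let `W₁` be a free hermitian scalar field of mass `m > 0` and
`W₂` a Wightman QFT of one hermitian scalar field on `ℝ^{1+3}`, with sharp-time restrictions
`T₁`, `T₂` satisfying the hypotheses of Thm 4-14 (`IsHaagSystem`; only `slice`, `hasDerivAt`,
`hermitian_φ` are consumed). If the time-zero two-point vacuum expectation values coincide,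
`⟪Ω₁, φ₁,₀(f) φ₁,₀(g) Ω₁⟫ = ⟪Ω₂, φ₂,₀(f) φ₂,₀(g) Ω₂⟫` for all `f, g ∈ 𝒮(ℝ³)` — S–W (4-85) — then
`W₂` is the free field of mass `m`: the conclusion of Thm 4-16 from the single consequence of
(4-73)–(4-76) that its printed proof uses (PDF p. 149), by the analytic-continuation step
(`wightmanFn_two_eq_of_equalTimeVEV_eq'`) and the Jost–Schroer theorem
(`JostSchroerTheorem_holds`); no unitary `V`, conjugate field, irreducibility or unique-vacuum
hypothesis is used. Barrier audit 2026-08-16 of `HaagTheoremSteps`.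
[cite: StreaterWightman2001, §4-5 proof of Thm 4-16, (4-85), held PDF p. 149]
[cite: Talagrand2022, App. M Thm M.4.12 and Lemma M.4.15, PDF p. 836] -/
theorem isFreeHermitianScalarField_of_equalTimeVEV_pair_eq {m : ℝ} (hm : 0 < m)
    {W₁ W₂ : WightmanData 3 Unit} {T₁ : SharpTimeField 3 W₁} {T₂ : SharpTimeField 3 W₂}
    (hfree : IsFreeHermitianScalarField 3 m W₁) (hW₂ : IsWightmanQFT W₂)
    (hT₁ : T₁.IsHaagSystem) (hT₂ : T₂.IsHaagSystem)
    (hvev : ∀ f g : 𝓢(EuclideanSpace ℝ (Fin 3), ℂ),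
      T₁.equalTimeVEV [(true, f), (true, g)] = T₂.equalTimeVEV [(true, f), (true, g)]) :
    IsFreeHermitianScalarField 3 m W₂ :=
  JostSchroerTheorem_holds m hm W₁ W₂ hfree hW₂ fun f =>
    (wightmanFn_two_eq_of_equalTimeVEV_eq' (m := 2) hfree.1 hW₂ hT₁ hT₂ hvev f).symm

end Literature.Barriers.QuantumFields
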